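import Literature.Geometry.Lorentzian.MassCapacity
import Literature.Geometry.Lorentzian.ExteriorRegion
import Literature.Geometry.Lorentzian.InverseMeanCurvatureFlowProofs
import Literature.Geometry.Lorentzian.AsymptoticallyFlatChart
import Literature.Geometry.Lorentzian.VolumeProofs
import Mathlib.Analysis.SpecialFunctions.SmoothTransition
import HarnessLib

/-!
# Mass–capacity inequalities: the empty horizon, Theorem 9 over the positive mass theorem, the capacity over smooth test functions, and finiteness of the capacity

Theorems only; sibling of `Literature.Geometry.Lorentzian.MassCapacity`, which vendors Bray,
J. Differential Geom. 59 (2001), §6, Def. 17 (the capacity `ℰ(Σ, g)` of a horizon,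
`horizonCapacity`) and Thm. 9 (`m ≥ ½ ℰ(Σ, g)`, the named fact
`Bray2001_mass_ge_half_capacity`; its case of equality, `Bray2001_capacity_rigidity`).

Bray opens §6 with: *"the theorems in this section, which follow from and generalize the
Riemannian positive mass theorem, are also of independent interest"*. The precise sense in which
Thm. 9 *generalizes* the positive mass theorem is its degenerate case of the **empty horizon**:
for `Σ = ∅` the class `𝒮` condition leaves the whole (connected, one-ended) manifold as the
outside region, the constant `1` is a test function of Def. 17, `ℰ(∅, g) = 0`
(`horizonCapacity_top`), and Thm. 9 reads `m ≥ 0`. This file machine-checks that reduction in the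
open-set encoding of `MassCapacity.lean`:

* `AFEnd.IsSoleEnd.isExteriorRegion_top`, `IsExteriorRegion.isSoleEnd_of_top`: on a connected
  data manifold, "`e` is the only end" (`AFEnd.IsSoleEnd`, the one-endedness hypothesis of the
  positive mass theorem in `MassInequalities.lean`) says exactly that the whole manifold `⊤` is
  the exterior region of `e` (`IsExteriorRegion e ⊤`);
* `IsOutsideOf.coe_eq_univ`, `IsOutsideOf.eq_top`, `IsOutsideOf.horizonCapacity_eq_zero`: an
  outside region (Bray's class `𝒮`, Def. 3) of the *empty* surface is all of `X`, and its
  capacity vanishes;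
* `isOutsideOf_top_emptySurface`: conversely `⊤` is the outside of the empty surface
  (`EmptySurface` of `ExteriorRegion.lean`) as soon as it is the exterior region of `e`;
* `Bray2001_mass_ge_half_capacity.admEnergy_nonneg`: the named fact
  `Bray2001_mass_ge_half_capacity` implies the Riemannian positive mass theorem in Bray's
  setting — complete, connected, one-ended time-symmetric data with `R(h) ≥ 0` and Def. 21 decay
  on the end (`h - δ = O₂(r⁻¹)`, `|R(h)| = O(r^{-q})`, `q > 3`) whose ADM energy limit exists have
  `0 ≤ E`.

So every discharge of `Bray2001_mass_ge_half_capacity` is in particular a proof of the positive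
mass theorem for this decay class (Bray's own proof of Thm. 9 invokes the positive mass theorem,
through Thm. 8, on the conformally compactified double of the outside region); the fact sits above
`positive_mass_theorem_riemannian` / `schoenYau_mass_nonneg` in the dependency order of the
`gr` facts.

The second part of the file machine-checks the *truncation argument* of the design notes of
`MassCapacity.lean` (there only asserted), which is what makes `horizonCapacity` faithful to
Def. 17: Bray's infimum is "over all smooth `φ(x)` which go to one at infinity and equal zero on
the horizon (and are zero inside `Σ`)", his minimiser (86) is smooth on the closed outside `M_Σ`
but only Lipschitz across `Σ`, and `IsCapacityTestFn` asks for continuity on `X` and smoothness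
on the *open* outside `U` only. We prove that the infimum over `IsCapacityTestFn e U` equals the
infimum over the subclass of *globally smooth* functions on `X` vanishing off `U`
(`horizonCapacity_eq_iInf_contMDiff`); Bray's class lies between the two, so all three numbers
agree.

* `gradNorm_eq_zero_of_eventuallyEq_const`: the slope `|∇u|_h (x)` vanishes where `u` is
  locally constant (locality of the slope, `gradNorm_congr_of_eventuallyEq` of
  `InverseMeanCurvatureFlowProofs.lean`);
* `hasMFDerivAt_real_comp`, `mfderiv_real_comp`, `gradNorm_real_comp`: the chain rule
  `d(G ∘ φ)_x = G'(φ x) dφ_x`, `|∇(G ∘ φ)|_h = |G'(φ)| |∇φ|_h` for `G : ℝ → ℝ`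
  (`innerDual_smul_self`: `h⁻¹(cα, cα) = c² h⁻¹(α, α)`);
* `exists_smooth_truncation`: smooth `G_δ : ℝ → ℝ` with `G_δ = 0` on `[-δ, δ]`, `G_δ(s) = s` for
  `|s| ≥ 2δ` and `|G_δ'| ≤ C` with `C` independent of `δ` (from `Real.smoothTransition`);
* `TendstoAtEnd.real_comp`, `IsCapacityTestFn.contMDiff_real_comp`,
  `IsCapacityTestFn.real_comp_eq_zero`: `G_δ ∘ φ` is a *globally smooth* test function — off `U`
  it vanishes on the whole neighbourhood `{|φ| < δ}`;
* `IsCapacityTestFn.dirichletEnergy_real_comp_le`: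
  `∫ |∇(G_δ ∘ φ)|² ≤ ∫ |∇φ|² + C² ∫_{0 < |φ| ≤ 2δ} |∇φ|²` (split the lower integral along the
  measurable collar; no measurability of `|∇φ|` is needed);
* `horizonCapacity_eq_iInf_contMDiff`: the two infima agree (the collar integrals of a
  finite-energy `φ` tend to `0` as `δ ↓ 0` by continuity from above of the measure `|∇φ|² dV_h`);
* `horizonCapacity_anti`: the capacity is antitone in the outside region, `U ≤ V` implies
  `ℰ(V) ≤ ℰ(U)` (an enclosing horizon has the larger capacity).

The third part proves that **the capacity is finite** (`horizonCapacity_lt_top`; also asserted,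
not proved, in the design notes of `MassCapacity.lean`): if the end is asymptotically flat of
some order `α > 0` in the metric (only the order-zero part `‖h_ij - δ_ij‖ = O(r^{-α})` of
`AFEnd.IsMetricAsymptoticallyFlat` is used) and `U` is an exterior region of the end, then
`horizonCapacity D.h e U < ∞`; in particular under the hypotheses of
`Bray2001_mass_ge_half_capacity` (`IsOutsideOf.horizonCapacity_lt_top`), so that the `toReal` in
that fact loses nothing. The test function is the **end cut-off**
`χ(q) = S(‖coord q‖ - R₁)` with `S = Real.smoothTransition` and `coord` the chart of the end
(`AsymptoticallyFlatChart.lean`), `R₁` beyond the radius where `‖h_ij - δ_ij‖ ≤ ½`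
(`AFEnd.exists_radius_hCoeff_sub_innerSL_le`): it is globally smooth
(`AFEnd.contMDiff_endCutoff`, via `AFEnd.isClosed_far`), supported in `far R₁ ⊆ U`, tends to
`1`, its slope vanishes off the compact chart shell `Φ({R₁ ≤ ‖z‖ ≤ R₁ + 1})` and is bounded there
by `2C²` (`AFEnd.gradNorm_endCutoff_sq_le`: with `β = dχ_q`, `v = ♯β`, `c = dcoord_q v`,
`|∇χ|² = β(v) = h_q(v, v) = h_ij cⁱcʲ ≥ ½‖c‖²` by `AFEnd.hCoeff_coord_mfderiv`, while
`β(v) = DS(coord q)(c) ≤ C‖c‖` by the chain rule — no inverse of the chart differential and no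
continuity of the metric coefficients are needed), so that `∫ |∇χ|² ≤ 2C² vol_h(shell) < ∞` by
`riemannianVolume_lt_top_of_isCompact_holds` (`VolumeProofs.lean`).

## Mathlib

Used: `isClopen_iff_frontier_eq_empty`, `IsClopen.eq_univ`, `Manifold.locallyCompact_of_finiteDimensional`,
`borel`/`BorelSpace`, `TopologicalSpace.Opens`; `HasMFDerivAt.comp`, `hasMFDerivAt_iff_hasFDerivAt`,
`Filter.EventuallyEq.mfderiv_eq`, `ContDiff.comp_contMDiffAt`, `ContMDiffAt.congr_of_eventuallyEq`,
`Real.smoothTransition`, `IsCompact.exists_bound_of_continuousOn`, `Measure.restrict_add_restrict_compl`,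
`setLIntegral_mono'`, `lintegral_const_mul'`, `withDensity_apply`, `tendsto_measure_iInter_atTop`,
`ge_of_tendsto'`, `Asymptotics.IsBigO.bound`, `tendsto_rpow_neg_atTop`, `Filter.hasBasis_cobounded_norm`,
`ContinuousLinearMap.le_opNorm₂`, `contDiffAt_norm`, `Metric.isCompact_of_isClosed_isBounded`,
`Topology.IsEmbedding.subtypeVal`, `lintegral_indicator_const`; and from the Lorentz prelude `AFEnd.IsSoleEnd`,
`IsExteriorRegion`, `IsOutsideOf`, `horizonCapacity_top`, `horizonCapacity_le`, `IsCapacityTestFn`,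
`dirichletEnergy`, `gradNorm`, `innerDual`, `sharp`, `val_sharp_apply`, `endValue`, `TendstoAtEnd`,
`AFEnd.coord` (+ `contMDiffAt_coord`, `hCoeff_coord_mfderiv`, `coord_dataChart`, `mem_far_iff_coord`),
`AFEnd.hCoeff`, `AFEnd.IsMetricAsymptoticallyFlat`, `AFEnd.isClosed_far`, `riemannianVolume_lt_top_of_isCompact_holds`,
`EmptySurface`, `contMDiff_pullbackBilin_emptySurface`.

## References

* H. L. Bray, *Proof of the Riemannian Penrose inequality using the positive mass theorem*,
  J. Differential Geom. 59 (2001) 177–267 (arXiv:math/9911173): §2 Def. 3 (the class `𝒮`),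
  §6 (opening paragraph), Def. 17 and Thm. 9; §13 Def. 21.
* R. Schoen, S.-T. Yau, *On the proof of the positive mass conjecture in general relativity*,
  Comm. Math. Phys. 65 (1979) 45–76, Thm. 1.
* G. Huisken, T. Ilmanen, *The inverse mean curvature flow and the Riemannian Penrose
  inequality*, J. Differential Geom. 59 (2001) 353–437, §1 (cut-offs `G ∘ u` of locally
  Lipschitz functions and their slopes `|∇(G ∘ u)| = |G'(u)| |∇u|`).
* R. Bartnik, *The mass of an asymptotically flat manifold*, Comm. Pure Appl. Math. 39 (1986)
  661–693, §1 (1.3) and Def. 2.1 (the chart components `h_ij` and their decay).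
-/

noncomputable section

open Bundle Set Manifold TopologicalSpace Filter MeasureTheory Asymptotics
open scoped ContDiff Topology ENNReal Manifold Real

namespace Literature.Geometry.Lorentzian

open PseudoRiemannianMetric

variable {X : Type} [TopologicalSpace X] [ChartedSpace E3 X]

/-! ### One end: the whole manifold as the exterior region -/

/-- If `e` is the only end of the connected manifold `X` (the complement of a far region
`e.far R'` is compact), then the whole manifold is the exterior region of `e`: `⊤` is connected,
contains `e.far R'`, and `closure ⊤ ∖ e.far R' = (e.far R')ᶜ` is compact. This is the situation
"`Σ = ∅`, `M_Σ = M` has only the chosen end" of Bray 2001, §6 (Def. 17, Thm. 9).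
[cite: BrayRPI2001, §6 Def. 17 and §2 Def. 3] -/
theorem AFEnd.IsSoleEnd.isExteriorRegion_top [ConnectedSpace X] {e : AFEnd X}
    (he : e.IsSoleEnd) : IsExteriorRegion e ⊤ := by
  obtain ⟨R', hR', hK⟩ := he
  refine ⟨?_, R', hR', fun x _ ↦ ?_, ?_⟩
  · rw [Opens.coe_top]
    exact isConnected_univ
  · simp
  · rwa [Opens.coe_top, closure_univ, ← Set.compl_eq_univ_sdiff]

/-- Conversely, if the whole manifold is the exterior region of the end `e`, then `e` is the only
end of `X` (`(e.far R')ᶜ = closure ⊤ ∖ e.far R'` is compact). [folklore] -/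
theorem IsExteriorRegion.isSoleEnd_of_top {e : AFEnd X} (h : IsExteriorRegion e ⊤) :
    e.IsSoleEnd := by
  obtain ⟨-, R', hR', -, hK⟩ := h
  refine ⟨R', hR', ?_⟩
  rwa [Opens.coe_top, closure_univ, ← Set.compl_eq_univ_sdiff] at hK

/-- On a connected manifold, `⊤` is the exterior region of `e` iff `e` is the only end.
[folklore] -/
theorem isExteriorRegion_top_iff [ConnectedSpace X] (e : AFEnd X) :
    IsExteriorRegion e ⊤ ↔ e.IsSoleEnd :=
  ⟨IsExteriorRegion.isSoleEnd_of_top, AFEnd.IsSoleEnd.isExteriorRegion_top⟩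

/-! ### The outside region of the empty surface -/

/-- **The outside of the empty surface is everything.** If `U` is the outside region (Bray's
class `𝒮`, Def. 3: `frontier U = Σ`, `U` the connected exterior region of the end) of a surface
`f' : S' → X` with *no points*, then `frontier U = ∅`, so `U` is clopen, nonempty (it contains a
far region of the end) and hence all of the connected manifold `X`. Bray 2001, §6: for `Σ = ∅`
the closed outside `M_Σ` is `M`. [cite: BrayRPI2001, §2 Def. 3 and §6 Thm. 9] -/
theorem IsOutsideOf.coe_eq_univ [ConnectedSpace X] {e : AFEnd X} {U : Opens X} {S' : Type*}
    [IsEmpty S'] {f' : S' → X} {ν' : NormalField (𝓡 3) f'} (hU : IsOutsideOf e U f' ν') :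
    (U : Set X) = univ :=
  (isClopen_iff_frontier_eq_empty.2 (hU.frontier_eq.trans (range_eq_empty f'))).eq_univ
    hU.isExteriorRegion.nonempty

/-- The outside region of the empty surface is the top open set `⊤`. [folklore] -/
theorem IsOutsideOf.eq_top [ConnectedSpace X] {e : AFEnd X} {U : Opens X} {S' : Type*}
    [IsEmpty S'] {f' : S' → X} {ν' : NormalField (𝓡 3) f'} (hU : IsOutsideOf e U f' ν') :
    U = ⊤ :=
  SetLike.coe_injective (hU.coe_eq_univ.trans (Opens.coe_top (α := X)).symm)

/-- **The capacity of the empty horizon vanishes**: if `U` is the outside region of a surface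
with no points, then `ℰ(Σ, g) = horizonCapacity h e U = 0` (`U = ⊤` and `φ ≡ 1` is a test
function of zero energy, `horizonCapacity_top`), so that Thm. 9 for the empty horizon reads
`m ≥ 0`. Bray 2001, §6, Def. 17. [cite: BrayRPI2001, §6 Def. 17] -/
theorem IsOutsideOf.horizonCapacity_eq_zero [IsManifold (𝓡 3) ∞ X] [ConnectedSpace X]
    [T2Space X] [LocallyCompactSpace X] [MeasurableSpace X] [BorelSpace X]
    (h : ContMDiffRiemannianMetric (𝓡 3) ∞ E3 (TangentSpace (𝓡 3) : X → Type _))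
    {e : AFEnd X} {U : Opens X} {S' : Type*} [IsEmpty S'] {f' : S' → X}
    {ν' : NormalField (𝓡 3) f'} (hU : IsOutsideOf e U f' ν') : horizonCapacity h e U = 0 := by
  rw [hU.eq_top]
  exact horizonCapacity_top h e

/-- **`⊤` is the outside of the empty surface** towards `e` whenever it is the exterior region of
`e`: the boundary `frontier ⊤ = ∅` is the (empty) image of the empty surface `EmptySurface`
(`ExteriorRegion.lean`), and the two one-sidedness clauses of `IsOutsideOf` are vacuous. With
`AFEnd.IsSoleEnd.isExteriorRegion_top` this realises "`Σ = ∅ ∈ 𝒮`" for one-ended `X`.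
Bray 2001, §2 Def. 3. [cite: BrayRPI2001, §2 Def. 3] -/
theorem isOutsideOf_top_emptySurface {e : AFEnd X} (he : IsExteriorRegion e ⊤) :
    IsOutsideOf e ⊤ (isEmptyElim : EmptySurface → X) isEmptyElim :=
  ⟨by rw [Opens.coe_top, frontier_univ]; exact (range_eq_empty _).symm, fun y ↦ isEmptyElim y,
    fun y ↦ isEmptyElim y, he⟩

/-! ### Theorem 9 contains the positive mass theorem -/

/-- **Bray's Theorem 9 implies the Riemannian positive mass theorem** (for Bray's decay class).
If `Bray2001_mass_ge_half_capacity` holds (Bray, J. Differential Geom. 59 (2001), Thm. 9: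
`m ≥ ½ ℰ(Σ, g)` for every horizon `Σ ∈ 𝒮`), then for complete, connected time-symmetric data
`(X, h)` with `R(h) ≥ 0`, asymptotically flat of order `1` on the end `e` with
`|R(h)| = O(r^{-q})` for some `q > 3` (Def. 21), whose ADM energy limit exists and whose only end
is `e`, the ADM energy is nonnegative: `0 ≤ E`. Proof: apply the fact to the empty horizon — the
empty surface `EmptySurface` with its (vacuous) embedding, unit normal and minimality, whose
outside region is `⊤` (`isOutsideOf_top_emptySurface`, `AFEnd.IsSoleEnd.isExteriorRegion_top`) —
and use `ℰ(∅, g) = 0` (`horizonCapacity_top`); the Borel structure `borel X` and local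
compactness of the manifold `X` (`Manifold.locallyCompact_of_finiteDimensional`) supply the
instance hypotheses under which the capacity is formed. This is the remark opening §6 ("the
theorems in this section … follow from and generalize the Riemannian positive mass theorem") made
precise for Thm. 9, and it pins the trust base: any discharge of the fact proves the positive mass
theorem (Schoen–Yau 1979, Thm. 1) for this class.
[cite: BrayRPI2001, §6 (opening paragraph) and Thm. 9 with Def. 17] -/
theorem Bray2001_mass_ge_half_capacity.admEnergy_nonneg (hB : Bray2001_mass_ge_half_capacity)
    (X : Type) [TopologicalSpace X] [ChartedSpace E3 X] [IsManifold (𝓡 3) ∞ X] [T2Space X]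
    [SecondCountableTopology X] [ConnectedSpace X]
    (D : InitialDataSet (𝓡 3) X) [D.metric.HasLeviCivita] (e : AFEnd X)
    (hts : D.IsTimeSymmetric) (hR : ∀ x : X, 0 ≤ D.metric.scalarCurvature x)
    (hAF : e.IsAsymptoticallyFlat D 1)
    (hRq : ∃ q : ℝ, 3 < q ∧
      (fun x ↦ e.scalarCurvatureCoeff D x) =O[Bornology.cobounded E3] fun x ↦ ‖x‖ ^ (-q))
    (hcomp : D.IsComplete) (hADM : ∃ m, e.HasADMEnergy D m) (he : e.IsSoleEnd) :
    0 ≤ e.admEnergy D := by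
  -- the Borel structure and local compactness of `X`, to form the capacity
  letI : MeasurableSpace X := borel X
  haveI : BorelSpace X := ⟨rfl⟩
  haveI : LocallyCompactSpace X := Manifold.locallyCompact_of_finiteDimensional (M := X) (𝓡 3)
  -- Thm. 9 for the empty horizon, whose outside region is `⊤`
  have h9 := hB X D e ⊤ EmptySurface isEmptyElim isEmptyElim contMDiff_pullbackBilin_emptySurface
    ⟨fun y ↦ isEmptyElim y, fun y ↦ isEmptyElim y⟩ hts hR hAF hRq hcomp hADM
    ⟨⟨EuclideanSpace ℝ (Fin 1), inferInstance, inferInstance, fun y ↦ isEmptyElim y⟩,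
      .of_subsingleton _⟩
    ⟨fun y ↦ isEmptyElim y, fun y ↦ isEmptyElim y⟩ (fun y ↦ isEmptyElim y)
    (isOutsideOf_top_emptySurface he.isExteriorRegion_top)
  -- `ℰ(∅, g) = 0`
  rwa [horizonCapacity_top, ENNReal.toReal_zero, zero_div] at h9

/-! ## The capacity over globally smooth test functions (the truncation argument) -/

section Truncation

variable [IsManifold (𝓡 3) ∞ X]

/-! ### The slope of a composite `G ∘ φ` with a real function `G` -/

section Slope

variable (h : ContMDiffRiemannianMetric (𝓡 3) ∞ E3 (TangentSpace (𝓡 3) : X → Type _))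

/-- The inverse metric is quadratic under scaling of the covector: `h⁻¹(c α, c α) = c² h⁻¹(α, α)`.
[folklore] -/
theorem innerDual_smul_self (x : X) (c : ℝ) (α : Module.Dual ℝ (TangentSpace (𝓡 3) x)) :
    (ofRiemannian h).innerDual x (c • α) (c • α) = c ^ 2 * (ofRiemannian h).innerDual x α α := by
  simp only [PseudoRiemannianMetric.innerDual, map_smul, LinearMap.smul_apply, smul_eq_mul]
  ring

/-- A function that is constant near `x` has slope `0` at `x` (locality of the slope,
`gradNorm_congr_of_eventuallyEq` of `InverseMeanCurvatureFlowProofs.lean`). [folklore] -/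
theorem gradNorm_eq_zero_of_eventuallyEq_const {u : X → ℝ} {x : X} {c : ℝ}
    (hu : u =ᶠ[𝓝 x] fun _ ↦ c) : gradNorm h u x = 0 :=
  (gradNorm_congr_of_eventuallyEq h hu).trans (gradNorm_const h c x)

omit [IsManifold (𝓡 3) ∞ X] in
/-- **Chain rule for the differential of `G ∘ φ`, `G : ℝ → ℝ`**: if `G` has derivative `g'` at
`φ x` and `φ` is differentiable at `x`, then `d(G ∘ φ)_x = g' · dφ_x`. [folklore] -/
theorem hasMFDerivAt_real_comp {G : ℝ → ℝ} {g' : ℝ} {φ : X → ℝ} {x : X}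
    (hG : HasDerivAt G g' (φ x)) (hφ : MDifferentiableAt (𝓡 3) 𝓘(ℝ, ℝ) φ x) :
    HasMFDerivAt (𝓡 3) 𝓘(ℝ, ℝ) (G ∘ φ) x (g' • mfderiv (𝓡 3) 𝓘(ℝ, ℝ) φ x) := by
  have h1 : HasMFDerivAt 𝓘(ℝ, ℝ) 𝓘(ℝ, ℝ) G (φ x)
      (ContinuousLinearMap.smulRight (1 : ℝ →L[ℝ] ℝ) g') :=
    hasMFDerivAt_iff_hasFDerivAt.mpr hG.hasFDerivAt
  convert h1.comp x hφ.hasMFDerivAt using 1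
  ext v
  -- both sides are the real number `g' · dφ_x(v)` (the tangent spaces of `ℝ` are `ℝ`)
  exact mul_comm g' ((mfderiv (𝓡 3) 𝓘(ℝ, ℝ) φ x) v)

omit [IsManifold (𝓡 3) ∞ X] in
/-- `d(G ∘ φ)_x = G'(φ x) · dφ_x` for the `mfderiv`. [folklore] -/
theorem mfderiv_real_comp {G : ℝ → ℝ} {g' : ℝ} {φ : X → ℝ} {x : X}
    (hG : HasDerivAt G g' (φ x)) (hφ : MDifferentiableAt (𝓡 3) 𝓘(ℝ, ℝ) φ x) :
    mfderiv (𝓡 3) 𝓘(ℝ, ℝ) (G ∘ φ) x = g' • mfderiv (𝓡 3) 𝓘(ℝ, ℝ) φ x :=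
  (hasMFDerivAt_real_comp hG hφ).mfderiv

/-- **Chain rule for the slope**: `|∇(G ∘ φ)|_h (x) = |G'(φ x)| · |∇φ|_h (x)` at a point where
`φ` is differentiable (Huisken–Ilmanen 2001, §1, use this for the cut-offs of weak solutions;
Bray 2001, §6, for truncated test functions). [folklore] -/
theorem gradNorm_real_comp {G : ℝ → ℝ} {g' : ℝ} {φ : X → ℝ} {x : X}
    (hG : HasDerivAt G g' (φ x)) (hφ : MDifferentiableAt (𝓡 3) 𝓘(ℝ, ℝ) φ x) :
    gradNorm h (G ∘ φ) x = |g'| * gradNorm h φ x := by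
  have key : (ofRiemannian h).innerDual x (mfderiv (𝓡 3) 𝓘(ℝ, ℝ) (G ∘ φ) x).toLinearMap
      (mfderiv (𝓡 3) 𝓘(ℝ, ℝ) (G ∘ φ) x).toLinearMap = g' ^ 2 * (ofRiemannian h).innerDual x
        (mfderiv (𝓡 3) 𝓘(ℝ, ℝ) φ x).toLinearMap (mfderiv (𝓡 3) 𝓘(ℝ, ℝ) φ x).toLinearMap := by
    rw [mfderiv_real_comp hG hφ]
    exact innerDual_smul_self h x g' (mfderiv (𝓡 3) 𝓘(ℝ, ℝ) φ x).toLinearMap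
  unfold gradNorm
  rw [key, Real.sqrt_mul (sq_nonneg _), Real.sqrt_sq_eq_abs]

end Slope

/-! ### Smooth truncations near zero -/

/-- **Smooth truncation functions.** There is a constant `C ≥ 1` such that for every `δ > 0` there
is a smooth `G_δ : ℝ → ℝ` with `G_δ(s) = 0` for `|s| ≤ δ`, `G_δ(s) = s` for `|s| ≥ 2δ`, and
`|G_δ'| ≤ C` everywhere: `G_δ(s) = δ G₁(s/δ)` with `G₁(t) = t ψ(t)` for the smooth plateau
`ψ(t) = S(t - 1) + S(-t - 1)` built from Mathlib's `Real.smoothTransition` `S` (`ψ = 0` on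
`[-1, 1]`, `ψ = 1` off `(-2, 2)`), and `C = max (sup_{[-3,3]} |G₁'|) 1`. (The device behind
"the values of the capacity over Bray's test functions and over globally smooth ones agree, by
truncation" in the design notes of `MassCapacity.lean`.) [folklore] -/
theorem exists_smooth_truncation :
    ∃ C : ℝ, 1 ≤ C ∧ ∀ δ : ℝ, 0 < δ → ∃ G : ℝ → ℝ, ContDiff ℝ ∞ G ∧
      (∀ s, |s| ≤ δ → G s = 0) ∧ (∀ s, 2 * δ ≤ |s| → G s = s) ∧
      ∀ s, ∃ g' : ℝ, HasDerivAt G g' s ∧ |g'| ≤ C := by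
  -- the plateau `ψ = 0` on `[-1, 1]`, `ψ = 1` off `(-2, 2)`
  let ψ : ℝ → ℝ := fun t ↦ Real.smoothTransition (t - 1) + Real.smoothTransition (-t - 1)
  have hψs : ContDiff ℝ ∞ ψ :=
    (Real.smoothTransition.contDiff.comp (contDiff_id.sub contDiff_const)).add
      (Real.smoothTransition.contDiff.comp (contDiff_neg.sub contDiff_const))
  have hψ0 : ∀ t, |t| ≤ 1 → ψ t = 0 := fun t ht ↦ by
    have h := abs_le.1 ht
    simp only [ψ, Real.smoothTransition.zero_of_nonpos (by linarith : t - 1 ≤ 0),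
      Real.smoothTransition.zero_of_nonpos (by linarith : -t - 1 ≤ 0), add_zero]
  have hψ1 : ∀ t, 2 ≤ |t| → ψ t = 1 := fun t ht ↦ by
    rcases le_abs'.1 ht with ht | ht
    · simp only [ψ, Real.smoothTransition.zero_of_nonpos (by linarith : t - 1 ≤ 0),
        Real.smoothTransition.one_of_one_le (by linarith : 1 ≤ -t - 1), zero_add]
    · simp only [ψ, Real.smoothTransition.one_of_one_le (by linarith : 1 ≤ t - 1),
        Real.smoothTransition.zero_of_nonpos (by linarith : -t - 1 ≤ 0), add_zero]
  -- the model truncation `T t = t ψ t`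
  let T : ℝ → ℝ := fun t ↦ t * ψ t
  have hTs : ContDiff ℝ ∞ T := contDiff_id.mul hψs
  have hT0 : ∀ t, |t| ≤ 1 → T t = 0 := fun t ht ↦ by simp only [T, hψ0 t ht, mul_zero]
  have hT1 : ∀ t, 2 ≤ |t| → T t = t := fun t ht ↦ by simp only [T, hψ1 t ht, mul_one]
  have hTd : ∀ t, HasDerivAt T (deriv T t) t := fun t ↦
    ((hTs.differentiable (by simp)) t).hasDerivAt
  -- its derivative is continuous and equals `1` off `[-2, 2]`, hence is bounded
  have hTc : Continuous (deriv T) := hTs.continuous_deriv (by simp)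
  have hT2 : ∀ t, 2 < |t| → deriv T t = 1 := fun t ht ↦ by
    have hev : T =ᶠ[𝓝 t] id :=
      Filter.eventuallyEq_of_mem ((isOpen_lt continuous_const continuous_abs).mem_nhds ht)
        fun u hu ↦ hT1 u (le_of_lt hu)
    rw [hev.deriv_eq, deriv_id]
  obtain ⟨C₀, hC₀⟩ := (isCompact_Icc (a := (-3 : ℝ)) (b := 3)).exists_bound_of_continuousOn
    hTc.continuousOn
  have hC : ∀ t, |deriv T t| ≤ max C₀ 1 := fun t ↦ by
    by_cases ht : |t| ≤ 3
    · exact ((Real.norm_eq_abs _).symm.le.trans (hC₀ t (mem_Icc.2 (abs_le.1 ht)))).trans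
        (le_max_left _ _)
    · rw [hT2 t (by linarith [not_le.1 ht]), abs_one]
      exact le_max_right _ _
  refine ⟨max C₀ 1, le_max_right _ _, fun δ hδ ↦ ⟨fun s ↦ δ * T (s / δ), ?_, ?_, ?_, ?_⟩⟩
  · exact contDiff_const.mul (hTs.comp (contDiff_id.div_const δ))
  · intro s hs
    have hs' : |s / δ| ≤ 1 := by rwa [abs_div, abs_of_pos hδ, div_le_one hδ]
    simp only [hT0 _ hs', mul_zero]
  · intro s hs
    have hs' : 2 ≤ |s / δ| := by rwa [abs_div, abs_of_pos hδ, le_div_iff₀ hδ]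
    simp only [hT1 _ hs']
    field_simp
  · intro s
    refine ⟨deriv T (s / δ), ?_, hC _⟩
    have h2 := (((hTd (s / δ)).comp s ((hasDerivAt_id' s).div_const δ))).const_mul δ
    refine h2.congr_deriv ?_
    field_simp

/-! ### Test functions: truncation and the capacity over globally smooth test functions -/

section SmoothTestFunctions

variable {e : AFEnd X} {U : Opens X}

omit [IsManifold (𝓡 3) ∞ X] in
/-- **`φ ↦ G ∘ φ` preserves limits at infinity in an end**: if `φ → c` in `e` and `G` is continuous
at `c`, then `G ∘ φ → G c` in `e` (outside the ball, `G ∘ φ` read in the chart is `G` of `φ`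
read in the chart). [folklore] -/
theorem TendstoAtEnd.real_comp {φ : X → ℝ} {c : ℝ} (hφ : TendstoAtEnd e φ c) {G : ℝ → ℝ}
    (hG : ContinuousAt G c) : TendstoAtEnd e (G ∘ φ) (G c) := by
  have hev : endValue e (G ∘ φ) =ᶠ[Bornology.cobounded E3] (G ∘ endValue e φ) := by
    filter_upwards [eventually_cobounded_le_norm (E := E3) (e.R + 1)] with x hx
    have hx' : e.R < ‖x‖ := by linarith
    simp only [Function.comp_apply, endValue_of_lt e _ hx']
  exact (hG.tendsto.comp hφ).congr' hev.symm

omit [IsManifold (𝓡 3) ∞ X] in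
/-- **Truncated test functions are globally smooth.** If `φ` is a test function (continuous,
smooth on the open outside `U`, zero off `U`) and `G` is smooth with `G = 0` on `[-δ, δ]`,
`δ > 0`, then `G ∘ φ` is smooth on all of `X`: on `U` it is a composite of smooth maps, and each
point off `U` (where `φ = 0`) has the neighbourhood `{|φ| < δ}` on which `G ∘ φ ≡ 0`.
[folklore] -/
theorem IsCapacityTestFn.contMDiff_real_comp {φ : X → ℝ} (hφ : IsCapacityTestFn e U φ)
    {δ : ℝ} (hδ : 0 < δ) {G : ℝ → ℝ} (hGs : ContDiff ℝ ∞ G) (hG0 : ∀ s, |s| ≤ δ → G s = 0) :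
    ContMDiff (𝓡 3) 𝓘(ℝ, ℝ) ∞ (G ∘ φ) := fun x ↦ by
  by_cases hx : x ∈ (U : Set X)
  · exact hGs.comp_contMDiffAt (hφ.contMDiffOn.contMDiffAt (U.isOpen.mem_nhds hx))
  · have h0 : φ x = 0 := hφ.2.2.1 x hx
    have hV : {y | |φ y| < δ} ∈ 𝓝 x :=
      (isOpen_lt (continuous_abs.comp hφ.continuous) continuous_const).mem_nhds
        (by simpa [h0] using hδ)
    have hev : (G ∘ φ) =ᶠ[𝓝 x] fun _ ↦ (0 : ℝ) :=
      Filter.eventuallyEq_of_mem hV fun y hy ↦ hG0 _ (le_of_lt hy)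
    exact contMDiffAt_const.congr_of_eventuallyEq hev

omit [IsManifold (𝓡 3) ∞ X] in
/-- A truncated test function still vanishes off the outside region (`G 0 = 0`). [folklore] -/
theorem IsCapacityTestFn.real_comp_eq_zero {φ : X → ℝ} (hφ : IsCapacityTestFn e U φ)
    {δ : ℝ} (hδ : 0 < δ) {G : ℝ → ℝ} (hG0 : ∀ s, |s| ≤ δ → G s = 0) (x : X)
    (hx : x ∉ (U : Set X)) : (G ∘ φ) x = 0 := by
  simp only [Function.comp_apply, hφ.2.2.1 x hx, hG0 0 (by simpa using hδ.le)]

variable [T2Space X] [LocallyCompactSpace X] [MeasurableSpace X] [BorelSpace X]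
  (h : ContMDiffRiemannianMetric (𝓡 3) ∞ E3 (TangentSpace (𝓡 3) : X → Type _))

/-- **Energy of a truncated test function.** Let `φ` be a test function, `δ > 0`, and `G` a
truncation: `G = 0` on `[-δ, δ]`, `G(s) = s` for `|s| ≥ 2δ`, `|G'| ≤ C`. Then
`∫ |∇(G ∘ φ)|² ≤ ∫ |∇φ|² + C² ∫_{0 < |φ| ≤ 2δ} |∇φ|²`: pointwise, `|∇(G ∘ φ)| = 0` where
`|φ| < δ` (there `G ∘ φ` is locally zero), `= |∇φ|` where `|φ| > 2δ` (`G' = 1`), and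
`≤ C |∇φ|` on the collar `{0 < |φ| ≤ 2δ} ⊆ U` (chain rule; `φ` is smooth on `U ⊇ {φ ≠ 0}`); the
integral is split along the (measurable) collar. [folklore] -/
theorem IsCapacityTestFn.dirichletEnergy_real_comp_le {φ : X → ℝ} (hφ : IsCapacityTestFn e U φ)
    {δ C : ℝ} (hδ : 0 < δ) {G : ℝ → ℝ}
    (hG0 : ∀ s, |s| ≤ δ → G s = 0) (hG1 : ∀ s, 2 * δ ≤ |s| → G s = s)
    (hGd : ∀ s, ∃ g', HasDerivAt G g' s ∧ |g'| ≤ C) :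
    dirichletEnergy h (G ∘ φ) ≤ dirichletEnergy h φ +
      ENNReal.ofReal (C ^ 2) * ∫⁻ x in (fun x ↦ |φ x|) ⁻¹' Ioc 0 (2 * δ),
        ENNReal.ofReal (gradNorm h φ x ^ 2) ∂(riemannianMeasure h) := by
  have hT : MeasurableSet ((fun x ↦ |φ x|) ⁻¹' Ioc 0 (2 * δ)) :=
    (continuous_abs.comp hφ.continuous).measurable measurableSet_Ioc
  -- `φ` is differentiable where it does not vanish (such points lie in the open set `U`)
  have hdiff : ∀ x, φ x ≠ 0 → MDifferentiableAt (𝓡 3) 𝓘(ℝ, ℝ) φ x := fun x hx ↦ by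
    have hxU : x ∈ (U : Set X) := not_imp_comm.1 (hφ.2.2.1 x) hx
    exact (hφ.contMDiffOn.contMDiffAt (U.isOpen.mem_nhds hxU)).mdifferentiableAt (by simp)
  -- where `|φ| < δ`, `G ∘ φ` is locally zero
  have hsmall : ∀ x, |φ x| < δ → gradNorm h (G ∘ φ) x = 0 := fun x hx ↦
    gradNorm_eq_zero_of_eventuallyEq_const h (c := 0) (Filter.eventuallyEq_of_mem
      ((isOpen_lt (continuous_abs.comp hφ.continuous) continuous_const).mem_nhds hx)
      fun y hy ↦ hG0 _ (le_of_lt hy))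
  -- on the collar, `|∇(G ∘ φ)|² ≤ C² |∇φ|²`
  have hcollar : ∀ x ∈ (fun x ↦ |φ x|) ⁻¹' Ioc 0 (2 * δ),
      ENNReal.ofReal (gradNorm h (G ∘ φ) x ^ 2) ≤
        ENNReal.ofReal (C ^ 2) * ENNReal.ofReal (gradNorm h φ x ^ 2) := fun x hx ↦ by
    obtain ⟨g', hg', hg'C⟩ := hGd (φ x)
    have hx0 : φ x ≠ 0 := abs_pos.1 hx.1
    rw [gradNorm_real_comp h hg' (hdiff x hx0), mul_pow, ← ENNReal.ofReal_mul (sq_nonneg _)]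
    exact ENNReal.ofReal_le_ofReal (mul_le_mul_of_nonneg_right
      (pow_le_pow_left₀ (abs_nonneg _) hg'C 2) (sq_nonneg _))
  -- off the collar, `|∇(G ∘ φ)|² ≤ |∇φ|²`
  have hoff : ∀ x ∈ ((fun x ↦ |φ x|) ⁻¹' Ioc 0 (2 * δ))ᶜ,
      ENNReal.ofReal (gradNorm h (G ∘ φ) x ^ 2) ≤ ENNReal.ofReal (gradNorm h φ x ^ 2) := by
    intro x hx
    simp only [mem_compl_iff, mem_preimage, mem_Ioc, not_and, not_le] at hx
    by_cases hx0 : φ x = 0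
    · rw [hsmall x (by simpa [hx0] using hδ)]
      simp
    · have h2 : 2 * δ < |φ x| := hx (abs_pos.2 hx0)
      have hG' : HasDerivAt G 1 (φ x) :=
        (hasDerivAt_id' (φ x)).congr_of_eventuallyEq (Filter.eventuallyEq_of_mem
          ((isOpen_lt continuous_const continuous_abs).mem_nhds h2) fun s hs ↦ hG1 s (le_of_lt hs))
      rw [gradNorm_real_comp h hG' (hdiff x hx0), abs_one, one_mul]
  -- split the energy along the collar
  calc dirichletEnergy h (G ∘ φ)
      = (∫⁻ x in (fun x ↦ |φ x|) ⁻¹' Ioc 0 (2 * δ), ENNReal.ofReal (gradNorm h (G ∘ φ) x ^ 2)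
            ∂(riemannianMeasure h)) +
          ∫⁻ x in ((fun x ↦ |φ x|) ⁻¹' Ioc 0 (2 * δ))ᶜ, ENNReal.ofReal (gradNorm h (G ∘ φ) x ^ 2)
            ∂(riemannianMeasure h) := by
        rw [dirichletEnergy, ← lintegral_add_measure, Measure.restrict_add_restrict_compl hT]
    _ ≤ (∫⁻ x in (fun x ↦ |φ x|) ⁻¹' Ioc 0 (2 * δ),
            ENNReal.ofReal (C ^ 2) * ENNReal.ofReal (gradNorm h φ x ^ 2) ∂(riemannianMeasure h)) +
          ∫⁻ x in ((fun x ↦ |φ x|) ⁻¹' Ioc 0 (2 * δ))ᶜ, ENNReal.ofReal (gradNorm h φ x ^ 2)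
            ∂(riemannianMeasure h) :=
        add_le_add (setLIntegral_mono' hT hcollar) (setLIntegral_mono' hT.compl hoff)
    _ ≤ ENNReal.ofReal (C ^ 2) * (∫⁻ x in (fun x ↦ |φ x|) ⁻¹' Ioc 0 (2 * δ),
            ENNReal.ofReal (gradNorm h φ x ^ 2) ∂(riemannianMeasure h)) + dirichletEnergy h φ := by
        rw [lintegral_const_mul' _ _ ENNReal.ofReal_ne_top]
        exact add_le_add le_rfl (setLIntegral_le_lintegral _ _)
    _ = _ := add_comm _ _

/-- **The capacity over globally smooth test functions** (design note of `MassCapacity.lean`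
made a theorem). The capacity `ℰ(Σ, g) = horizonCapacity h e U` of Def. 17 — the infimum of
`(1/2π) ∫ |∇φ|²` over the test functions `IsCapacityTestFn e U` (continuous, smooth on the open
outside `U`, zero on `Σ` and inside, `→ 1` at infinity) — equals the infimum over the *subclass*
of globally smooth functions on `X` vanishing off `U` and tending to `1`. Since Bray's own class
(functions smooth on the closed outside `M_Σ` up to `Σ`, extended by zero) lies between the two,
all three infima coincide and `horizonCapacity` is Bray's number `ℰ(Σ, g)`. Proof: truncate a
test function `φ` of finite energy by the `G_δ` of `exists_smooth_truncation`: `G_δ ∘ φ` is a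
smooth test function (`IsCapacityTestFn.contMDiff_real_comp`) with
`∫ |∇(G_δ ∘ φ)|² ≤ ∫ |∇φ|² + C² ∫_{0 < |φ| ≤ 2δ} |∇φ|²`
(`IsCapacityTestFn.dirichletEnergy_real_comp_le`), and the collar integrals tend to `0` as
`δ = 1/(2(n+1)) → 0` by continuity from above of the finite measure `|∇φ|² dV_h` along the
decreasing measurable collars `{0 < |φ| ≤ 2δ}` with empty intersection. Bray 2001, §6, Def. 17
("the infimum is taken over all smooth `φ(x)` which go to one at infinity and equal zero on the
horizon"). [cite: BrayRPI2001, §6 Def. 17] -/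
theorem horizonCapacity_eq_iInf_contMDiff (e : AFEnd X) (U : Opens X) :
    horizonCapacity h e U = ⨅ (φ : X → ℝ) (_ : ContMDiff (𝓡 3) 𝓘(ℝ, ℝ) ∞ φ ∧
      (∀ x, x ∉ (U : Set X) → φ x = 0) ∧ TendstoAtEnd e φ 1),
      ENNReal.ofReal (2 * π)⁻¹ * dirichletEnergy h φ := by
  refine le_antisymm (le_iInf₂ fun φ hφ ↦
    horizonCapacity_le h e U (IsCapacityTestFn.of_contMDiff hφ.1 hφ.2.1 hφ.2.2)) ?_
  refine le_iInf₂ fun φ hφ ↦ ?_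
  -- infinite energy: nothing to prove
  by_cases hE : dirichletEnergy h φ = ⊤
  · rw [hE, ENNReal.mul_top (ENNReal.ofReal_pos.2 (by positivity)).ne']
    exact le_top
  -- the truncations `G n` at scale `δ n = 1 / (2 (n + 1))`
  obtain ⟨C, hC1, hG⟩ := exists_smooth_truncation
  set δ : ℕ → ℝ := fun n ↦ 1 / (2 * (n + 1)) with hδ_def
  have hδ : ∀ n, 0 < δ n := fun n ↦ by positivity
  have hδ1 : ∀ n, 2 * δ n ≤ 1 := fun n ↦ by
    have hn : (1 : ℝ) ≤ n + 1 := by linarith [n.cast_nonneg (α := ℝ)]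
    rw [hδ_def, mul_one_div, div_le_one (by positivity)]
    linarith
  choose G hGs hG0 hG1 hGd using fun n ↦ hG (δ n) (hδ n)
  -- the collar integrals tend to zero
  have hT : ∀ n, MeasurableSet ((fun x ↦ |φ x|) ⁻¹' Ioc 0 (2 * δ n)) := fun n ↦
    (continuous_abs.comp hφ.continuous).measurable measurableSet_Ioc
  have hlim : Tendsto (fun n ↦ ∫⁻ x in (fun x ↦ |φ x|) ⁻¹' Ioc 0 (2 * δ n),
      ENNReal.ofReal (gradNorm h φ x ^ 2) ∂(riemannianMeasure h)) atTop (𝓝 0) := by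
    have hanti : Antitone fun n ↦ (fun x ↦ |φ x|) ⁻¹' Ioc 0 (2 * δ n) := by
      intro n m hnm
      refine preimage_mono (Ioc_subset_Ioc_right ?_)
      have : (n : ℝ) ≤ m := Nat.cast_le.2 hnm
      simp only [hδ_def]
      gcongr
    have hinter : ⋂ n, (fun x ↦ |φ x|) ⁻¹' Ioc 0 (2 * δ n) = ∅ := by
      refine Set.subset_empty_iff.1 fun x hx ↦ ?_
      rw [mem_iInter] at hx
      obtain ⟨n, hn⟩ := exists_nat_one_div_lt (hx 0).1
      have h2 : |φ x| ≤ 2 * δ n := (hx n).2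
      have h3 : 2 * δ n = 1 / (n + 1) := by
        rw [hδ_def]
        field_simp
      linarith
    have hfin : (riemannianMeasure h).withDensity (fun x ↦ ENNReal.ofReal (gradNorm h φ x ^ 2))
        ((fun x ↦ |φ x|) ⁻¹' Ioc 0 (2 * δ 0)) ≠ ⊤ := by
      refine ne_top_of_le_ne_top hE ?_
      rw [withDensity_apply _ (hT 0)]
      exact setLIntegral_le_lintegral _ _
    have hμ := tendsto_measure_iInter_atTop
      (μ := (riemannianMeasure h).withDensity fun x ↦ ENNReal.ofReal (gradNorm h φ x ^ 2))
      (fun n ↦ (hT n).nullMeasurableSet) hanti ⟨0, hfin⟩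
    rw [hinter, measure_empty] at hμ
    refine hμ.congr fun n ↦ ?_
    simp only [Function.comp_apply, withDensity_apply _ (hT n)]
  -- the bound through the `n`-th truncation
  have hbound : ∀ n, (⨅ (ψ : X → ℝ) (_ : ContMDiff (𝓡 3) 𝓘(ℝ, ℝ) ∞ ψ ∧
      (∀ x, x ∉ (U : Set X) → ψ x = 0) ∧ TendstoAtEnd e ψ 1),
      ENNReal.ofReal (2 * π)⁻¹ * dirichletEnergy h ψ) ≤
      ENNReal.ofReal (2 * π)⁻¹ * (dirichletEnergy h φ + ENNReal.ofReal (C ^ 2) *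
        ∫⁻ x in (fun x ↦ |φ x|) ⁻¹' Ioc 0 (2 * δ n), ENNReal.ofReal (gradNorm h φ x ^ 2)
          ∂(riemannianMeasure h)) := fun n ↦ by
    have h1 : TendstoAtEnd e (G n ∘ φ) 1 := by
      have h1' := hφ.tendstoAtEnd.real_comp (hGs n).continuous.continuousAt
      rwa [hG1 n 1 (by simpa using hδ1 n)] at h1'
    exact (iInf₂_le (G n ∘ φ) ⟨hφ.contMDiff_real_comp (hδ n) (hGs n) (hG0 n),
      hφ.real_comp_eq_zero (hδ n) (hG0 n), h1⟩).trans
      (mul_le_mul_right (hφ.dirichletEnergy_real_comp_le h (hδ n) (hG0 n) (hG1 n) (hGd n)) _)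
  -- pass to the limit
  have hl := ENNReal.Tendsto.const_mul (tendsto_const_nhds.add
    (ENNReal.Tendsto.const_mul hlim (Or.inr ENNReal.ofReal_ne_top))) (Or.inr ENNReal.ofReal_ne_top)
    (a := ENNReal.ofReal (2 * π)⁻¹) (b := dirichletEnergy h φ + ENNReal.ofReal (C ^ 2) * 0)
  rw [mul_zero, add_zero] at hl
  exact ge_of_tendsto' hl hbound

/-- **The capacity is monotone under enclosure**: if `U ≤ V` are open outside regions, then
`horizonCapacity h e V ≤ horizonCapacity h e U` — a horizon enclosing another one (smaller
outside) has the larger capacity. Immediate on globally smooth test functions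
(`horizonCapacity_eq_iInf_contMDiff`): a smooth function vanishing off `U` vanishes off `V`.
[cite: BrayRPI2001, §6 Def. 17] -/
theorem horizonCapacity_anti (e : AFEnd X) {U V : Opens X} (hUV : U ≤ V) :
    horizonCapacity h e V ≤ horizonCapacity h e U := by
  rw [horizonCapacity_eq_iInf_contMDiff h e U, horizonCapacity_eq_iInf_contMDiff h e V]
  exact le_iInf₂ fun φ hφ ↦ iInf₂_le φ ⟨hφ.1, fun x hx ↦ hφ.2.1 x fun hxU ↦ hx (hUV hxU), hφ.2.2⟩

end SmoothTestFunctions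

end Truncation

/-! ## Finiteness of the capacity (the end cut-off of the end) -/

section Finiteness

namespace AFEnd

variable [IsManifold (𝓡 3) ∞ X] (e : AFEnd X) (D : InitialDataSet (𝓡 3) X)

-- the operator norm on `E3 →L[ℝ] E3 →L[ℝ] ℝ` is slow to synthesize through `PiLp`
set_option synthInstance.maxHeartbeats 80000 in
variable {e D} in
/-- **Far out, the chart components of `h` are within `½` of `δ`**: under the order-zero part of
`h_ij - δ_ij = O₂(r^{-α})`, `α > 0`, there is `R₀` with `‖h_ij(y) - δ_ij‖ ≤ ½` for `‖y‖ ≥ R₀`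
(operator norm), so that `½ ‖w‖² ≤ h_ij(y) wⁱ wʲ` there. Bartnik 1986, Def. 2.1.
[cite: Bartnik1986, Def. 2.1] -/
theorem exists_radius_hCoeff_sub_innerSL_le {α : ℝ} (hα : 0 < α)
    (h : e.IsMetricAsymptoticallyFlat D α) :
    ∃ R₀ : ℝ, ∀ y : E3, R₀ ≤ ‖y‖ →
      ‖hCoeff e D y - (innerSL ℝ : E3 →L[ℝ] E3 →L[ℝ] ℝ)‖ ≤ 1 / 2 := by
  obtain ⟨c, hc⟩ := (h 0 (Nat.zero_le _)).bound
  have ht : Tendsto (fun y : E3 ↦ c * ‖y‖ ^ (-α)) (Bornology.cobounded E3) (𝓝 (c * 0)) :=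
    ((tendsto_rpow_neg_atTop hα).comp tendsto_norm_cobounded_atTop).const_mul c
  rw [mul_zero] at ht
  have h1 : ∀ᶠ y in Bornology.cobounded E3,
      ‖hCoeff e D y - (innerSL ℝ : E3 →L[ℝ] E3 →L[ℝ] ℝ)‖ ≤ 1 / 2 := by
    filter_upwards [hc, ht.eventually (gt_mem_nhds (show (0 : ℝ) < 1 / 2 by norm_num))]
      with y hy hy'
    rw [norm_iteratedFDeriv_zero, norm_norm, Nat.cast_zero, sub_zero,
      Real.norm_of_nonneg (Real.rpow_nonneg (norm_nonneg _) _)] at hy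
    exact hy.trans hy'.le
  obtain ⟨r, -, hr⟩ := (Filter.hasBasis_cobounded_norm (E := E3)).eventually_iff.1 h1
  exact ⟨r, fun y hy ↦ hr hy⟩

-- the operator norm on `E3 →L[ℝ] E3 →L[ℝ] ℝ` is slow to synthesize through `PiLp`
set_option synthInstance.maxHeartbeats 80000 in
variable {e D} in
/-- If `‖h_ij(y) - δ_ij‖ ≤ ½` then `½ ‖w‖² ≤ h_ij(y) wⁱ wʲ`. [folklore] -/
theorem half_norm_sq_le_hCoeff {y : E3}
    (hy : ‖hCoeff e D y - (innerSL ℝ : E3 →L[ℝ] E3 →L[ℝ] ℝ)‖ ≤ 1 / 2) (w : E3) :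
    1 / 2 * ‖w‖ ^ 2 ≤ hCoeff e D y w w := by
  set A := hCoeff e D y - (innerSL ℝ : E3 →L[ℝ] E3 →L[ℝ] ℝ) with hA_def
  have hδ : (innerSL ℝ : E3 →L[ℝ] E3 →L[ℝ] ℝ) w w = ‖w‖ ^ 2 := by
    rw [← real_inner_self_eq_norm_sq]
    rfl
  have hdec : hCoeff e D y w w = A w w + ‖w‖ ^ 2 := by
    simp only [hA_def, sub_apply, hδ]
    ring
  have hAw : |A w w| ≤ 1 / 2 * ‖w‖ ^ 2 := by
    rw [← Real.norm_eq_abs]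
    calc ‖A w w‖ ≤ ‖A‖ * ‖w‖ * ‖w‖ := A.le_opNorm₂ w w
      _ ≤ 1 / 2 * ‖w‖ * ‖w‖ := by gcongr
      _ = 1 / 2 * ‖w‖ ^ 2 := by ring
  rw [hdec]
  linarith [(abs_le.1 hAw).1]

omit [IsManifold (𝓡 3) ∞ X] in
/-- The closed far piece `{q ∈ U | R₁ ≤ ‖coord q‖}` of the end, through `coord`. [folklore] -/
theorem mem_image_preimage_le_norm_iff {R₁ : ℝ} {q : X} :
    q ∈ ((↑) : e.U → X) '' (e.chart ⁻¹' {x | R₁ ≤ ‖(x : E3)‖}) ↔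
      ∃ _ : q ∈ e.U, R₁ ≤ ‖e.coord q‖ := by
  constructor
  · rintro ⟨u, hu, rfl⟩
    refine ⟨u.2, ?_⟩
    rw [e.coord_of_mem u.2]
    simpa using hu
  · rintro ⟨hq, hR⟩
    refine ⟨⟨q, hq⟩, ?_, rfl⟩
    rw [e.coord_of_mem hq] at hR
    simpa using hR

omit [IsManifold (𝓡 3) ∞ X] in
/-- Off the end, `coord` is the junk value `0`. [folklore] -/
theorem coord_of_not_mem {q : X} (hq : q ∉ e.U) : e.coord q = 0 := by
  classical
  exact dif_neg hq

/-! #### The end cut-off of the end -/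

/-- The **radial profile**: `y ↦ S(‖y‖ - R₁)` on `ℝ³` (`S` = `Real.smoothTransition`) is smooth
for `R₁ > 0` (it vanishes on the ball `‖y‖ < R₁`, a neighbourhood of the origin where the norm
is not differentiable). [folklore] -/
theorem contDiff_smoothTransition_norm_sub {R₁ : ℝ} (hR₁ : 0 < R₁) :
    ContDiff ℝ ∞ fun y : E3 ↦ Real.smoothTransition (‖y‖ - R₁) := by
  refine contDiff_iff_contDiffAt.2 fun y ↦ ?_
  by_cases hy : ‖y‖ < R₁
  · have hev : (fun y : E3 ↦ Real.smoothTransition (‖y‖ - R₁)) =ᶠ[𝓝 y] fun _ ↦ 0 :=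
      Filter.eventuallyEq_of_mem ((isOpen_lt continuous_norm continuous_const).mem_nhds hy)
        fun z hz ↦ Real.smoothTransition.zero_of_nonpos (by linarith [hz.out])
    exact contDiffAt_const.congr_of_eventuallyEq hev
  · have hy0 : y ≠ 0 := by
      rintro rfl
      exact hy (by simpa using hR₁)
    exact Real.smoothTransition.contDiff.contDiffAt.comp y
      ((contDiffAt_norm ℝ hy0).sub contDiffAt_const)

/-! The **end cut-off** of the end at radius `R₁` is the function
`χ(q) = S(‖coord q‖ - R₁)` on `X` (`S = Real.smoothTransition`; junk-free: off the end `coord = 0`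
and `χ = 0`). It is written out in full in the statements below (no auxiliary definition). -/

omit [IsManifold (𝓡 3) ∞ X] in
/-- The end cut-off `S(‖coord q‖ - R₁)` vanishes where `‖coord‖ ≤ R₁`. [folklore] -/
theorem endCutoff_eq_zero {R₁ : ℝ} {q : X} (hq : ‖e.coord q‖ ≤ R₁) :
    Real.smoothTransition (‖e.coord q‖ - R₁) = 0 :=
  Real.smoothTransition.zero_of_nonpos (by linarith)

omit [IsManifold (𝓡 3) ∞ X] in
/-- The end cut-off is `1` where `‖coord‖ ≥ R₁ + 1`. [folklore] -/
theorem endCutoff_eq_one {R₁ : ℝ} {q : X} (hq : R₁ + 1 ≤ ‖e.coord q‖) :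
    Real.smoothTransition (‖e.coord q‖ - R₁) = 1 :=
  Real.smoothTransition.one_of_one_le (by linarith)

omit [IsManifold (𝓡 3) ∞ X] in
/-- The end cut-off is supported in the far region `far R₁`. [folklore] -/
theorem mem_far_of_endCutoff_ne_zero {R₁ : ℝ} (hR₁ : 0 ≤ R₁) {q : X}
    (hq : Real.smoothTransition (‖e.coord q‖ - R₁) ≠ 0) : q ∈ e.far R₁ := by
  rw [e.mem_far_iff_coord]
  have hR : R₁ < ‖e.coord q‖ := not_le.1 fun h ↦ hq (e.endCutoff_eq_zero h)
  by_cases hqU : q ∈ e.U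
  · exact ⟨hqU, hR⟩
  · rw [e.coord_of_not_mem hqU, norm_zero] at hR
    exact absurd hR (not_lt.2 hR₁)

omit [IsManifold (𝓡 3) ∞ X] in
/-- Off the closed far piece `{q ∈ U | R₁ ≤ ‖coord q‖}` (an open set, `AFEnd.isClosed_far`), the
end cut-off vanishes identically; in particular it is locally zero there. [folklore] -/
theorem endCutoff_eventuallyEq_zero {R₁ : ℝ} (hR₁ : e.R < R₁) {q : X}
    (hq : q ∉ ((↑) : e.U → X) '' (e.chart ⁻¹' {x | R₁ ≤ ‖(x : E3)‖})) :
    (fun q ↦ Real.smoothTransition (‖e.coord q‖ - R₁)) =ᶠ[𝓝 q] fun _ ↦ 0 := by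
  refine Filter.eventuallyEq_of_mem ((e.isClosed_far R₁ hR₁).isOpen_compl.mem_nhds hq)
    fun p hp ↦ e.endCutoff_eq_zero ?_
  rw [mem_compl_iff, e.mem_image_preimage_le_norm_iff, not_exists] at hp
  by_cases hpU : p ∈ e.U
  · exact le_of_lt (not_le.1 (hp hpU))
  · rw [e.coord_of_not_mem hpU, norm_zero]
    exact le_of_lt (e.R_pos.trans hR₁)

omit [IsManifold (𝓡 3) ∞ X] in
/-- On the far region `far (R₁ + 1)` (an open set) the end cut-off is identically `1`.
[folklore] -/
theorem endCutoff_eventuallyEq_one {R₁ : ℝ} {q : X} (hq : q ∈ e.far (R₁ + 1)) :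
    (fun q ↦ Real.smoothTransition (‖e.coord q‖ - R₁)) =ᶠ[𝓝 q] fun _ ↦ 1 := by
  refine Filter.eventuallyEq_of_mem ((e.isOpen_far (R₁ + 1)).mem_nhds hq)
    fun p hp ↦ e.endCutoff_eq_one ?_
  obtain ⟨-, hp⟩ := e.mem_far_iff_coord.1 hp
  exact hp.le

omit [IsManifold (𝓡 3) ∞ X] in
/-- **The end cut-off is smooth on `X`** (`R₁ > R`): on the end it is the smooth radial
profile of the smooth coordinate function, and off the closed far piece it is locally zero.
[folklore] -/
theorem contMDiff_endCutoff {R₁ : ℝ} (hR₁ : e.R < R₁) :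
    ContMDiff (𝓡 3) 𝓘(ℝ, ℝ) ∞ (fun q ↦ Real.smoothTransition (‖e.coord q‖ - R₁)) := fun q ↦ by
  by_cases hq : q ∈ ((↑) : e.U → X) '' (e.chart ⁻¹' {x | R₁ ≤ ‖(x : E3)‖})
  · obtain ⟨hqU, -⟩ := e.mem_image_preimage_le_norm_iff.1 hq
    exact (contDiff_smoothTransition_norm_sub (e.R_pos.trans hR₁)).comp_contMDiffAt
      (e.contMDiffAt_coord hqU)
  · exact contMDiffAt_const.congr_of_eventuallyEq (e.endCutoff_eventuallyEq_zero hR₁ hq)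

omit [IsManifold (𝓡 3) ∞ X] in
/-- The end cut-off tends to `1` at infinity in the end (it equals `1` for `‖x‖ ≥ R₁ + 1`).
[folklore] -/
theorem tendstoAtEnd_endCutoff (R₁ : ℝ) :
    TendstoAtEnd e (fun q ↦ Real.smoothTransition (‖e.coord q‖ - R₁)) 1 := by
  refine tendsto_const_nhds.congr' ?_
  filter_upwards [eventually_cobounded_le_norm (E := E3) (max (R₁ + 1) (e.R + 1))] with x hx
  have hxR : e.R < ‖x‖ := by linarith [le_max_right (R₁ + 1) (e.R + 1)]
  rw [endValue_of_lt e _ hxR]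
  refine (e.endCutoff_eq_one ?_).symm
  rw [e.coord_dataChart]
  exact (le_max_left _ _).trans hx

/-- **Pointwise bound for the slope of the end cut-off on the end.** At a point `q` of the
end with `‖h_ij(coord q) - δ_ij‖ ≤ ½` and `‖D(S(‖·‖ - R₁))(coord q)‖ ≤ C` (`C ≥ 0`), the slope
satisfies `|∇χ|²_h (q) ≤ 2 C²`. Proof: with `β = dχ_q`, `v = ♯β` and `c = dcoord_q(v) ∈ ℝ³`,
`|∇χ|² = β(v) = h_q(v, v) = h_ij cⁱ cʲ ≥ ½ ‖c‖²` (`hCoeff_coord_mfderiv`), while by the chain rule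
`β(v) = D(S(‖·‖ - R₁))(coord q)(c) ≤ C ‖c‖`; hence `‖c‖ ≤ 2C` and `|∇χ|² ≤ 2C²`. [folklore] -/
theorem gradNorm_endCutoff_sq_le {R₁ C : ℝ} (hR₁ : e.R < R₁) (hC : 0 ≤ C) {q : X}
    (hqU : q ∈ e.U)
    (hclose : ‖hCoeff e D (e.coord q) - (innerSL ℝ : E3 →L[ℝ] E3 →L[ℝ] ℝ)‖ ≤ 1 / 2)
    (hderiv : ‖fderiv ℝ (fun y : E3 ↦ Real.smoothTransition (‖y‖ - R₁)) (e.coord q)‖ ≤ C) :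
    gradNorm D.h (fun q ↦ Real.smoothTransition (‖e.coord q‖ - R₁)) q ^ 2 ≤ 2 * C ^ 2 := by
  -- notation: the radial profile `F`, the differential `β = dχ_q` as a covector, `v = ♯β`,
  -- and the coordinate image `c = dcoord_q(v)`
  set χ : X → ℝ := fun q ↦ Real.smoothTransition (‖e.coord q‖ - R₁) with hχ_def
  set F : E3 → ℝ := fun y ↦ Real.smoothTransition (‖y‖ - R₁) with hF_def
  have hFs : ContDiff ℝ ∞ F := contDiff_smoothTransition_norm_sub (e.R_pos.trans hR₁)
  have hχF : χ = F ∘ e.coord := rfl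
  set β : Module.Dual ℝ (TangentSpace (𝓡 3) q) :=
    (mfderiv (𝓡 3) 𝓘(ℝ, ℝ) χ q).toLinearMap with hβ_def
  set v : TangentSpace (𝓡 3) q := (ofRiemannian D.h).sharp q β with hv_def
  set c : E3 := mfderiv (𝓡 3) 𝓘(ℝ, E3) e.coord q v with hc_def
  -- `|∇χ|² = β v = h(v, v)`
  have h0 : 0 ≤ (ofRiemannian D.h).innerDual q β β := by
    rw [innerDual_eq_val_sharp_sharp]
    by_cases hv0 : (ofRiemannian D.h).sharp q β = 0
    · simp [hv0]
    · exact (D.h.pos q _ hv0).le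
  have hsq : gradNorm D.h χ q ^ 2 = β v := by
    rw [show gradNorm D.h χ q = √((ofRiemannian D.h).innerDual q β β) from rfl,
      Real.sq_sqrt h0]
    rfl
  have hvv : D.metric.val q v v = β v := val_sharp_apply (ofRiemannian D.h) q β v
  -- `h(v, v) = h_ij cⁱ cʲ ≥ ½ ‖c‖²`
  have hcoord : hCoeff e D (e.coord q) c c = D.metric.val q v v :=
    e.hCoeff_coord_mfderiv D ⟨q, hqU⟩ v
  have hlow : 1 / 2 * ‖c‖ ^ 2 ≤ β v := by
    rw [← hvv, ← hcoord]
    exact half_norm_sq_le_hCoeff hclose c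
  -- chain rule: `β v = DF(coord q) c ≤ C ‖c‖`
  have hcomp : mfderiv (𝓡 3) 𝓘(ℝ, ℝ) χ q =
      (fderiv ℝ F (e.coord q)).comp (mfderiv (𝓡 3) 𝓘(ℝ, E3) e.coord q) := by
    have hcd : MDifferentiableAt (𝓡 3) 𝓘(ℝ, E3) e.coord q :=
      (e.contMDiffAt_coord hqU).mdifferentiableAt (by simp)
    have hFd : MDifferentiableAt 𝓘(ℝ, E3) 𝓘(ℝ, ℝ) F (e.coord q) :=
      ((hFs.differentiable (by simp)) _).mdifferentiableAt
    rw [hχF, mfderiv_comp q hFd hcd, mfderiv_eq_fderiv]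
    rfl
  have hchain : β v = fderiv ℝ F (e.coord q) c := by
    rw [hβ_def, hcomp]
    rfl
  have hup : β v ≤ C * ‖c‖ := by
    rw [hchain]
    exact (le_abs_self _).trans ((Real.norm_eq_abs _).symm.le.trans
      (((fderiv ℝ F (e.coord q)).le_opNorm c).trans (mul_le_mul_of_nonneg_right hderiv
        (norm_nonneg _))))
  -- combine: `‖c‖ ≤ 2C`, hence `β v ≤ 2C²`
  rw [hsq]
  have hc2 : ‖c‖ ≤ 2 * C := by
    by_cases hc0 : ‖c‖ = 0
    · rw [hc0]; positivity
    · have hcpos : 0 < ‖c‖ := (norm_nonneg _).lt_of_ne (Ne.symm hc0)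
      nlinarith
  nlinarith [norm_nonneg c]

end AFEnd

variable [IsManifold (𝓡 3) ∞ X] [T2Space X] [LocallyCompactSpace X] [MeasurableSpace X]
  [BorelSpace X]

/-- **The capacity of a horizon is finite.** If the end `e` is asymptotically flat of some order
`α > 0` in the metric (`h_ij - δ_ij = O₂(r^{-α})`; only the order-zero part is used) and `U` is
an exterior region of `e` (it contains a far region `far R'`, `R' > R`), then
`ℰ(Σ, g) = horizonCapacity D.h e U < ∞`. Proof: the end cut-off `χ = S(‖coord‖ - R₁)`,
`R₁ ≥ R'` beyond the radius where `‖h_ij - δ_ij‖ ≤ ½`, is a globally smooth test function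
(`AFEnd.contMDiff_endCutoff`, supported in `far R₁ ⊆ U`, `→ 1`); its slope vanishes off the
compact chart shell `Φ({R₁ ≤ ‖z‖ ≤ R₁ + 1})` (where `χ` is locally constant) and is bounded by
`2C²` on it (`AFEnd.gradNorm_endCutoff_sq_le`, `C` a bound for the derivative of the radial
profile on the shell), so `∫ |∇χ|² ≤ 2C² · vol_h(shell) < ∞` by
`riemannianVolume_lt_top_of_isCompact_holds`. This is the remark "the capacity is finite (test
functions equal to `1` outside a compact set have finite energy)" of the design notes of
`MassCapacity.lean`. [cite: BrayRPI2001, §6 Def. 17] -/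
theorem horizonCapacity_lt_top (D : InitialDataSet (𝓡 3) X) (e : AFEnd X) {U : Opens X} {α : ℝ}
    (hα : 0 < α) (hAF : e.IsMetricAsymptoticallyFlat D α) (hU : IsExteriorRegion e U) :
    horizonCapacity D.h e U < ⊤ := by
  obtain ⟨-, R', hR', hfar, -⟩ := hU
  obtain ⟨R₀, hR₀⟩ := AFEnd.exists_radius_hCoeff_sub_innerSL_le hα hAF
  -- radii `R < R' ≤ R₁`, `R₀ ≤ R₁`, shell `R₁ ≤ ‖z‖ ≤ R₁ + 1`
  set R₁ : ℝ := max R' R₀ with hR₁_def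
  have hR₁ : e.R < R₁ := hR'.trans_le (le_max_left _ _)
  have hR₁0 : 0 < R₁ := e.R_pos.trans hR₁
  -- the radial profile and a bound for its derivative on the shell
  set F : E3 → ℝ := fun y ↦ Real.smoothTransition (‖y‖ - R₁) with hF_def
  have hFs : ContDiff ℝ ∞ F := AFEnd.contDiff_smoothTransition_norm_sub hR₁0
  set K : Set E3 := {y | R₁ ≤ ‖y‖ ∧ ‖y‖ ≤ R₁ + 1} with hK_def
  have hK : IsCompact K := by
    refine Metric.isCompact_of_isClosed_isBounded
      (isClosed_le continuous_const continuous_norm |>.inter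
        (isClosed_le continuous_norm continuous_const)) ?_
    refine (Metric.isBounded_closedBall (x := (0 : E3)) (r := R₁ + 1)).subset fun y hy ↦ ?_
    rw [mem_closedBall_zero_iff]
    exact hy.2
  obtain ⟨C₀, hC₀⟩ := hK.exists_bound_of_continuousOn (hFs.continuous_fderiv (by simp)).continuousOn
  set C : ℝ := max C₀ 0 with hC_def
  have hC : 0 ≤ C := le_max_right _ _
  -- the test function
  set χ : X → ℝ := fun q ↦ Real.smoothTransition (‖e.coord q‖ - R₁) with hχ_def
  have hχs : ContMDiff (𝓡 3) 𝓘(ℝ, ℝ) ∞ χ := e.contMDiff_endCutoff hR₁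
  have hχ0 : ∀ x, x ∉ (U : Set X) → χ x = 0 := fun x hx ↦ by
    by_contra h
    exact hx (hfar (e.far_mono (le_max_left _ _) (e.mem_far_of_endCutoff_ne_zero hR₁0.le h)))
  have hχ1 : TendstoAtEnd e χ 1 := e.tendstoAtEnd_endCutoff R₁
  -- the compact shell carrying the slope
  set S : Set X := e.dataChart '' ((Subtype.val : exteriorRegion e.R → E3) ⁻¹' K) with hS_def
  have hKsub : K ⊆ range (Subtype.val : exteriorRegion e.R → E3) := fun y hy ↦ by
    rw [Subtype.range_coe_subtype]
    exact mem_exteriorRegion.2 (hR₁.trans_le hy.1)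
  have hSc : IsCompact S := by
    refine IsCompact.image ?_ e.contMDiff_dataChart.continuous
    rw [Topology.IsEmbedding.subtypeVal.isCompact_iff, image_preimage_eq_inter_range,
      inter_eq_left.2 hKsub]
    exact hK
  have hSm : MeasurableSet S := hSc.measurableSet
  -- off the shell the slope vanishes; on it, it is at most `2C²`
  have hslope : ∀ q, ENNReal.ofReal (gradNorm D.h χ q ^ 2) ≤
      S.indicator (fun _ ↦ ENNReal.ofReal (2 * C ^ 2)) q := fun q ↦ by
    by_cases hqS : q ∈ S
    · rw [indicator_of_mem hqS]
      obtain ⟨z, hz, rfl⟩ := hqS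
      have hqU : e.dataChart z ∈ e.U := (e.chart.symm z).2
      refine ENNReal.ofReal_le_ofReal (e.gradNorm_endCutoff_sq_le D hR₁ hC hqU ?_ ?_)
      · rw [e.coord_dataChart]
        exact hR₀ _ ((le_max_right _ _).trans hz.1)
      · rw [e.coord_dataChart]
        exact (hC₀ _ hz).trans (le_max_left _ _)
    · rw [indicator_of_notMem hqS]
      -- `q ∉ S`: either off the closed far piece (χ locally 0) or in `far (R₁ + 1)` (χ locally 1)
      have hzero : gradNorm D.h χ q = 0 := by
        by_cases hq : q ∈ ((↑) : e.U → X) '' (e.chart ⁻¹' {x | R₁ ≤ ‖(x : E3)‖})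
        · obtain ⟨hqU, hqR⟩ := e.mem_image_preimage_le_norm_iff.1 hq
          have hq2 : R₁ + 1 < ‖e.coord q‖ := by
            by_contra h2
            refine hqS ⟨⟨e.coord q, e.lt_norm_coord hqU⟩, ⟨hqR, not_lt.1 h2⟩, ?_⟩
            exact e.dataChart_coord hqU
          exact gradNorm_eq_zero_of_eventuallyEq_const D.h
            (e.endCutoff_eventuallyEq_one (e.mem_far_iff_coord.2 ⟨hqU, hq2⟩))
        · exact gradNorm_eq_zero_of_eventuallyEq_const D.h
            (e.endCutoff_eventuallyEq_zero hR₁ hq)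
      simp [hzero]
  -- the energy is finite
  have hvol : riemannianMeasure D.h S < ⊤ :=
    riemannianVolume_lt_top_of_isCompact_holds (I := 𝓡 3) (N := X) D.h le_rfl hSc
  have hE : dirichletEnergy D.h χ < ⊤ := by
    calc dirichletEnergy D.h χ
        ≤ ∫⁻ q, S.indicator (fun _ ↦ ENNReal.ofReal (2 * C ^ 2)) q ∂(riemannianMeasure D.h) :=
          lintegral_mono hslope
      _ = ENNReal.ofReal (2 * C ^ 2) * riemannianMeasure D.h S := lintegral_indicator_const hSm _
      _ < ⊤ := ENNReal.mul_lt_top ENNReal.ofReal_lt_top hvol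
  -- conclude
  exact (horizonCapacity_le_of_contMDiff D.h e U hχs hχ0 hχ1).trans_lt
    (ENNReal.mul_lt_top ENNReal.ofReal_lt_top hE)

/-- **The capacity of a horizon in Bray's class `𝒮` is finite** under the hypotheses of
`Bray2001_mass_ge_half_capacity` (asymptotic flatness of order `1` of the end, `U` the outside
region of the horizon), so that `ℰ(Σ, g) = (horizonCapacity D.h e U).toReal` in that fact loses
nothing. [cite: BrayRPI2001, §6 Def. 17 with Def. 21] -/
theorem IsOutsideOf.horizonCapacity_lt_top (D : InitialDataSet (𝓡 3) X) {e : AFEnd X}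
    {U : Opens X} {S' : Type*} {f' : S' → X} {ν' : NormalField (𝓡 3) f'}
    (hAF : e.IsAsymptoticallyFlat D 1) (hU : IsOutsideOf e U f' ν') :
    horizonCapacity D.h e U < ⊤ :=
  Literature.Geometry.Lorentzian.horizonCapacity_lt_top D e one_pos
    hAF.isMetricAsymptoticallyFlat hU.isExteriorRegion

end Finiteness

end Literature.Geometry.Lorentzian

end
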